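import Summits.ValiantsHypothesis.ValiantsHypothesis.Theorems.NcParseTreeValues
import HarnessLib

/-!
# Binarisation of noncommutative circuits preserving parse trees (LLS18 Lemma 8) — definitions

LLS18 = Lagarde–Limaye–Srinivasan 2018. Lemma 8 (p. 9): «a UPT circuit of size s with product
gates of arbitrary fan-in is converted to an equivalent UPT circuit with product fan-in ≤ 2 and
size O(s), by replacing each product gate `u₁ ⋯ u_k` with the chain of `k − 1` binary products
`((u₁u₂)u₃)⋯u_k`; the parse trees of the new circuit are the left-combings of the old ones».
THIS FILE (definitions + structure): (§1) the PARSE TREES of a circuit with product gates of ANY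
fan-in, a `k`-ary product node being RECORDED as its left comb `((t₁t₂)t₃)⋯t_k` in the binary
`Shape` (`combCircuitPts`; fan-in 1 transparent, fan-in 2 = the landed `circuitPts`, and
`combCircuitPts P = circuitPts P` LITERALLY when every product gate has fan-in ≤ 2,
`combCircuitPts_eq_circuitPts`); (§2) the BINARISATION `binz P` — gate `m` of `P` becomes the
BLOCK of `width` consecutive gates starting at the prefix sum `boff P.gates m`, references
`gate j` are renumbered to the LAST slot `btbl P.gates j` of block `j`; a product
`u₁ ⋯ u_k` (`k ≥ 2`) becomes `u₁·u₂, g·u₃, …, g·u_k` (`chainGates`), sums / copies / empty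
products are kept (one slot); (§3) slot arithmetic (`boff`, `btbl`), size
`(binz P).size = Σ_gates max(1, fanIn − 1) ≤ P.size + P.edgeSize` (gates + wires; print measures size
by WIRES, LLS18 p. 7, so this is `O(s)`). The fan-in / no-`const` transfer, the parse-tree identity
`circuitPts (binz P) = combCircuitPts P` and the value theorem are in `NcBinarisationParseTrees`;
the UPT-normal-form and PERM/LID transfers in `NcBinarisationPermanent`.
MODEL (the sentence of bus OFFER 2482 / CALL 2483, VERBATIM): «Circuits ArithCircuit R σ read in
FreeAlgebra R σ (ncEval): weighted sum gates of any fan-in, ORDERED product gates of ANY fan-in; NO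
`const` operands (print: inputs are variables, constants live on the + wires, LLS18 p. 7) and, for
the value theorems, NO EMPTY products (prod [] computes 1, which has no parse tree). A parse tree
keeps one summand of every sum gate and ALL factors of every product gate; a k-ary product node is
RECORDED as its left comb ((t₁t₂)t₃)⋯t_k in the binary Shape (fan-in 1 transparent, fan-in 2 = the
landed circuitPts, LITERAL agreement combCircuitPts P = circuitPts P when all product fan-ins ≤ 2).
PRINT-UPT of shape T (LLS18 §3, any fan-in) ⇒ comb-UPT (all comb parse trees have one shape, the
comb of T); NOT conversely (the encoding forgets arities) — so every bound stated against comb-UPT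
circuits IS a bound against print-UPT circuits of arbitrary product fan-in, size measured by gates +
wires (print measures wires). Comb-rotUPT is a KERNEL class: = print-rotUPT (LLS18 §4) at fan-in ≤
2, INCOMPARABLE with it at fan-in ≥ 3 (reordering three children is not a rotation of the comb:
comb_rot_witness) — the Rot statements are NOT print-rotUPT for fan-in ≥ 3. binz = LLS18 Lemma 8's
chain of k−1 binary products with references renumbered by prefix sums; (binz P).size = Σ max(1,
fanIn−1) ≤ P.size + P.edgeSize. The constants are those of the landed transfers (WEAKER than the
typed rungs). NOT a new lower bound; 0 S-currency; closes NO item; A_nc stmt-23446 / PerNotNcVP / VP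
≠ VNP untouched.»
[cite: LagardeLimayeSrinivasan2018, §2 (p. 7–8), §3 Lemma 8 (p. 9)]
[cite: LimayeMalodSrinivasan2016, §7]
-/

noncomputable section

namespace Summit.ValiantsHypothesis.ValiantsHypothesis.Theorems.NcBinarisation

set_option linter.dupNamespace false
open Literature.Computability.AlgebraicComplexity
  Literature.Computability.AlgebraicComplexity.ArithCircuit
  Summit.ValiantsHypothesis.ValiantsHypothesis.Theorems.NcUniqueParseTree
  Summit.ValiantsHypothesis.ValiantsHypothesis.Theorems.NcParseTrees

universe u v

variable {R : Type u} {σ : Type v}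

section Comb
variable [CommSemiring R]

/-! ### §1 Parse trees with product gates of any fan-in (left-comb encoding) -/

/-- Fold a product chain: the comb parse trees of `acc · u₁ ⋯ u_k`.
[cite: LagardeLimayeSrinivasan2018, §2, §3 Lemma 8] -/
def chainPts (W : List (List (Shape × FreeAlgebra R σ))) (acc : List (Shape × FreeAlgebra R σ))
    (rest : List (Operand R σ)) : List (Shape × FreeAlgebra R σ) :=
  rest.foldl (fun acc u => pairPts acc (opPts W u)) acc

/-- Comb parse trees of a gate: sums as `gatePts`; a product `u₁ ⋯ u_k` (`k ≥ 1`) has the parse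
trees of all choices, joined as the left comb; the empty product has none.
[cite: LagardeLimayeSrinivasan2018, §2, §3 Lemma 8] -/
def combGatePts (W : List (List (Shape × FreeAlgebra R σ))) :
    Gate R σ → List (Shape × FreeAlgebra R σ)
  | .sum args => sumPts W args
  | .prod [] => []
  | .prod (u :: rest) => chainPts W (opPts W u) rest

/-- Comb parse-tree lists of a gate list (left fold, as `ptLists`).
[cite: LagardeLimayeSrinivasan2018, §2] -/
def combPtLists (gs : List (Gate R σ)) : List (List (Shape × FreeAlgebra R σ)) :=
  gs.foldl (fun W g => W ++ [combGatePts W g]) []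

/-- `T(C)` for product gates of any fan-in (comb encoding), each parse tree with its term.
[cite: LagardeLimayeSrinivasan2018, §2] -/
def combCircuitPts (P : ArithCircuit R σ) : List (Shape × FreeAlgebra R σ) :=
  opPts (combPtLists P.gates) P.output

/-- Chain step. [cite: LagardeLimayeSrinivasan2018, §3 Lemma 8] -/
theorem chainPts_cons (W : List (List (Shape × FreeAlgebra R σ))) (acc : List (Shape × FreeAlgebra R σ))
    (u : Operand R σ) (rest : List (Operand R σ)) :
    chainPts W acc (u :: rest) = chainPts W (pairPts acc (opPts W u)) rest := rfl

/-- Chain, last factor. [cite: LagardeLimayeSrinivasan2018, §3 Lemma 8] -/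
theorem chainPts_append_singleton (W : List (List (Shape × FreeAlgebra R σ)))
    (acc : List (Shape × FreeAlgebra R σ)) (rest : List (Operand R σ)) (u : Operand R σ) :
    chainPts W acc (rest ++ [u]) = pairPts (chainPts W acc rest) (opPts W u) := by
  simp [chainPts, List.foldl_append]

/-- Fan-in ≤ 2: the comb parse trees of a gate ARE its parse trees.
[cite: LagardeLimayeSrinivasan2018, §2] -/
theorem combGatePts_eq_gatePts (W : List (List (Shape × FreeAlgebra R σ))) (g : Gate R σ)
    (hg : ∀ args, g = Gate.prod args → args.length ≤ 2) : combGatePts W g = gatePts W g := by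
  rcases g with args | (_ | ⟨u, _ | ⟨u', _ | ⟨u'', rest⟩⟩⟩)
  · rfl
  · rfl
  · rfl
  · rfl
  · have h := hg _ rfl
    simp at h

/-- One step of the fold. [cite: LagardeLimayeSrinivasan2018, §2] -/
theorem combPtLists_append_singleton (gs : List (Gate R σ)) (g : Gate R σ) :
    combPtLists (gs ++ [g]) = combPtLists gs ++ [combGatePts (combPtLists gs) g] := by
  simp [combPtLists, List.foldl_append]

/-- One list per gate. [cite: LagardeLimayeSrinivasan2018, §2] -/
theorem length_combPtLists (gs : List (Gate R σ)) : (combPtLists gs).length = gs.length := by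
  induction gs using List.reverseRecOn with
  | nil => rfl
  | append_singleton gs g ih =>
    rw [combPtLists_append_singleton, List.length_append, List.length_append, ih]; rfl

/-- Appending gates keeps the earlier lists. [cite: LagardeLimayeSrinivasan2018, §2] -/
theorem combPtLists_getD_append (gs t : List (Gate R σ)) {j : ℕ} (hj : j < gs.length) :
    (combPtLists (gs ++ t)).getD j [] = (combPtLists gs).getD j [] := by
  induction t using List.reverseRecOn with
  | nil => rw [List.append_nil]
  | append_singleton t g ih =>
    rw [← List.append_assoc, combPtLists_append_singleton,
      List.getD_append _ _ _ _ (by rw [length_combPtLists, List.length_append]; omega), ih]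

/-- Fan-in ≤ 2: the comb lists ARE the parse-tree lists. [cite: LagardeLimayeSrinivasan2018, §2] -/
theorem combPtLists_eq_ptLists (gs : List (Gate R σ))
    (hp : ∀ args, Gate.prod args ∈ gs → args.length ≤ 2) : combPtLists gs = ptLists gs := by
  induction gs using List.reverseRecOn with
  | nil => rfl
  | append_singleton gs g ih =>
    rw [combPtLists_append_singleton, ptLists_append_singleton,
      ih fun args h => hp args (List.mem_append_left _ h),
      combGatePts_eq_gatePts _ g fun args h => hp args (by rw [← h]; simp)]

/-- ★ LITERAL AGREEMENT: when every product gate has fan-in ≤ 2, `combCircuitPts P` is the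
landed `circuitPts P`. MODEL (module docstring);
NOT a new lower bound; 0 S-currency; closes NO item; A_nc stmt-23446 / PerNotNcVP / VP ≠ VNP untouched.
[cite: LagardeLimayeSrinivasan2018, §2] -/
theorem combCircuitPts_eq_circuitPts (P : ArithCircuit R σ)
    (hp : ∀ args, Gate.prod args ∈ P.gates → args.length ≤ 2) :
    combCircuitPts P = circuitPts P := by
  rw [combCircuitPts, circuitPts, combPtLists_eq_ptLists P.gates hp]

end Comb

/-! ### §2 The binarisation (LLS18 Lemma 8) — purely syntactic, no semiring structure used -/

/-- Number of slots of the block of a gate: `max 1 (fanIn − 1)` for products, `1` for sums.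
[cite: LagardeLimayeSrinivasan2018, §3 Lemma 8] -/
def width : Gate R σ → ℕ
  | .sum _ => 1
  | .prod [] => 1
  | .prod [_] => 1
  | .prod (_ :: _ :: rest) => rest.length + 1

/-- First slot of block `m`: the prefix sum of the widths.
[cite: LagardeLimayeSrinivasan2018, §3 Lemma 8] -/
def boff (G : List (Gate R σ)) (m : ℕ) : ℕ :=
  ((G.take m).map width).sum

/-- Renumbering table: `gate j` ↦ the LAST slot of block `j` (out of range stays out of range).
[cite: LagardeLimayeSrinivasan2018, §3 Lemma 8] -/
def btbl (G : List (Gate R σ)) (j : ℕ) : ℕ :=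
  boff G j + width (G.getD j (Gate.sum [])) - 1

/-- Renumber the gate references of an operand. [cite: LagardeLimayeSrinivasan2018, §3 Lemma 8] -/
def bop (tbl : ℕ → ℕ) : Operand R σ → Operand R σ
  | .var x => .var x
  | .const c => .const c
  | .gate j => .gate (tbl j)

/-- The chain `g_p · u₃, g_{p+1} · u₄, …` continuing a product from slot `p`.
[cite: LagardeLimayeSrinivasan2018, §3 Lemma 8] -/
def chainGates (tbl : ℕ → ℕ) : ℕ → List (Operand R σ) → List (Gate R σ)
  | _, [] => []
  | p, u :: rest => Gate.prod [.gate p, bop tbl u] :: chainGates tbl (p + 1) rest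

/-- The block of a gate placed at slot `pos`. [cite: LagardeLimayeSrinivasan2018, §3 Lemma 8] -/
def block (tbl : ℕ → ℕ) (pos : ℕ) : Gate R σ → List (Gate R σ)
  | .sum args => [.sum (args.map fun a => (a.1, bop tbl a.2))]
  | .prod [] => [.prod []]
  | .prod [u] => [.prod [bop tbl u]]
  | .prod (u :: u' :: rest) => .prod [bop tbl u, bop tbl u'] :: chainGates tbl pos rest

/-- The blocks of a gate list, laid out consecutively from slot `pos`.
[cite: LagardeLimayeSrinivasan2018, §3 Lemma 8] -/
def binBlocks (tbl : ℕ → ℕ) : ℕ → List (Gate R σ) → List (Gate R σ)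
  | _, [] => []
  | pos, g :: gs => block tbl pos g ++ binBlocks tbl (pos + width g) gs

/-- ★ The BINARISATION of a circuit (LLS18 Lemma 8). MODEL (module docstring);
NOT a new lower bound; 0 S-currency; closes NO item; A_nc stmt-23446 / PerNotNcVP / VP ≠ VNP untouched.
[cite: LagardeLimayeSrinivasan2018, §3 Lemma 8] -/
def binz (P : ArithCircuit R σ) : ArithCircuit R σ where
  gates := binBlocks (btbl P.gates) 0 P.gates
  output := bop (btbl P.gates) P.output

/-! ### §3 Structure: lengths, slot arithmetic, size, fan-in and no-const transfer -/

/-- [cite: LagardeLimayeSrinivasan2018, §3 Lemma 8] -/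
theorem one_le_width (g : Gate R σ) : 1 ≤ width g := by
  rcases g with _ | (_ | ⟨_, _ | ⟨_, _⟩⟩) <;> simp [width]

/-- [cite: LagardeLimayeSrinivasan2018, §3 Lemma 8] -/
theorem width_le (g : Gate R σ) : width g ≤ g.fanIn + 1 := by
  rcases g with _ | (_ | ⟨_, _ | ⟨_, _⟩⟩) <;>
    simp only [width, Gate.fanIn, Gate.args, List.length_cons, List.length_map, List.length_nil] <;>
    omega

/-- [cite: LagardeLimayeSrinivasan2018, §3 Lemma 8] -/
theorem chainGates_cons (tbl : ℕ → ℕ) (p : ℕ) (u : Operand R σ) (rest : List (Operand R σ)) :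
    chainGates tbl p (u :: rest) = Gate.prod [.gate p, bop tbl u] :: chainGates tbl (p + 1) rest :=
  rfl

/-- [cite: LagardeLimayeSrinivasan2018, §3 Lemma 8] -/
theorem length_chainGates (tbl : ℕ → ℕ) (p : ℕ) (rest : List (Operand R σ)) :
    (chainGates tbl p rest).length = rest.length := by
  induction rest generalizing p with
  | nil => rfl
  | cons u rest ih => rw [chainGates_cons, List.length_cons, List.length_cons, ih]

/-- [cite: LagardeLimayeSrinivasan2018, §3 Lemma 8] -/
theorem chainGates_append (tbl : ℕ → ℕ) (rest : List (Operand R σ)) (u : Operand R σ) (p : ℕ) :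
    chainGates tbl p (rest ++ [u]) =
      chainGates tbl p rest ++ [Gate.prod [.gate (p + rest.length), bop tbl u]] := by
  induction rest generalizing p with
  | nil => simp [chainGates]
  | cons v rest ih =>
    rw [List.cons_append, chainGates_cons, chainGates_cons, ih, List.cons_append, List.length_cons,
      Nat.add_assoc, Nat.add_comm 1 rest.length]

/-- [cite: LagardeLimayeSrinivasan2018, §3 Lemma 8] -/
theorem length_block (tbl : ℕ → ℕ) (pos : ℕ) (g : Gate R σ) :
    (block tbl pos g).length = width g := by
  rcases g with _ | (_ | ⟨_, _ | ⟨_, rest⟩⟩) <;> simp [block, width, length_chainGates]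

/-- [cite: LagardeLimayeSrinivasan2018, §3 Lemma 8] -/
theorem binBlocks_cons (tbl : ℕ → ℕ) (pos : ℕ) (g : Gate R σ) (gs : List (Gate R σ)) :
    binBlocks tbl pos (g :: gs) = block tbl pos g ++ binBlocks tbl (pos + width g) gs := rfl

/-- [cite: LagardeLimayeSrinivasan2018, §3 Lemma 8] -/
theorem length_binBlocks (tbl : ℕ → ℕ) (pos : ℕ) (gs : List (Gate R σ)) :
    (binBlocks tbl pos gs).length = (gs.map width).sum := by
  induction gs generalizing pos with
  | nil => rfl
  | cons g gs ih => rw [binBlocks_cons, List.length_append, length_block, ih, List.map_cons,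
      List.sum_cons]

/-- Laying out one more gate. [cite: LagardeLimayeSrinivasan2018, §3 Lemma 8] -/
theorem binBlocks_append (tbl : ℕ → ℕ) (gs : List (Gate R σ)) (g : Gate R σ) (pos : ℕ) :
    binBlocks tbl pos (gs ++ [g]) =
      binBlocks tbl pos gs ++ block tbl (pos + (gs.map width).sum) g := by
  induction gs generalizing pos with
  | nil => simp [binBlocks]
  | cons g' gs ih =>
    rw [List.cons_append, binBlocks_cons, binBlocks_cons, ih, List.append_assoc, List.map_cons,
      List.sum_cons, Nat.add_assoc]

/-- [cite: LagardeLimayeSrinivasan2018, §3 Lemma 8] -/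
theorem boff_succ (G : List (Gate R σ)) {m : ℕ} (hm : m < G.length) :
    boff G (m + 1) = boff G m + width G[m] := by
  rw [boff, boff, List.take_succ_eq_append_getElem hm, List.map_append, List.sum_append,
    List.map_singleton, List.sum_singleton]

/-- [cite: LagardeLimayeSrinivasan2018, §3 Lemma 8] -/
theorem boff_mono (G : List (Gate R σ)) : Monotone (boff G) :=
  monotone_nat_of_le_succ fun m => by
    rcases Nat.lt_or_ge m G.length with hm | hm
    · rw [boff_succ G hm]; exact Nat.le_add_right _ _
    · simp only [boff, List.take_of_length_le hm, List.take_of_length_le (Nat.le_succ_of_le hm),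
        le_refl]

/-- [cite: LagardeLimayeSrinivasan2018, §3 Lemma 8] -/
theorem boff_of_length_le (G : List (Gate R σ)) {m : ℕ} (hm : G.length ≤ m) :
    boff G m = boff G G.length := by
  simp only [boff, List.take_of_length_le hm, List.take_length]

/-- [cite: LagardeLimayeSrinivasan2018, §3 Lemma 8] -/
theorem boff_le_btbl (G : List (Gate R σ)) (j : ℕ) : boff G j ≤ btbl G j := by
  have := one_le_width (G.getD j (Gate.sum []))
  rw [btbl]; omega

/-- (T1) The slot of an EARLIER gate lies before block `m`.
[cite: LagardeLimayeSrinivasan2018, §3 Lemma 8] -/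
theorem btbl_lt_boff (G : List (Gate R σ)) {j m : ℕ} (hj : j < m) (hm : m ≤ G.length) :
    btbl G j < boff G m := by
  have hjG : j < G.length := by omega
  have h1 : boff G (j + 1) = boff G j + width G[j] := boff_succ G hjG
  have h2 : boff G (j + 1) ≤ boff G m := boff_mono G (by omega)
  have h3 : 1 ≤ width G[j] := one_le_width _
  rw [btbl, List.getD_eq_getElem _ _ hjG]; omega

/-- (T2) The slot of a LATER (or out-of-range) reference lies at or after the last slot of
block `m`. [cite: LagardeLimayeSrinivasan2018, §3 Lemma 8] -/
theorem boff_succ_le_btbl (G : List (Gate R σ)) {j m : ℕ} (hj : m ≤ j) (hm : m < G.length) :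
    boff G (m + 1) ≤ btbl G j + 1 := by
  have hw := one_le_width (G.getD j (Gate.sum []))
  rcases Nat.lt_or_ge j G.length with hjG | hjG
  · have h1 : boff G (j + 1) = boff G j + width (G.getD j (Gate.sum [])) := by
      rw [boff_succ G hjG, List.getD_eq_getElem _ _ hjG]
    have h2 : boff G (m + 1) ≤ boff G (j + 1) := boff_mono G (by omega)
    rw [btbl]; omega
  · have h2 : boff G (m + 1) ≤ boff G G.length := boff_mono G (by omega)
    rw [btbl, boff_of_length_le G hjG]; omega

/-- ★ SIZE of the binarisation: `Σ_gates max(1, fanIn − 1)` slots. MODEL (module docstring);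
NOT a new lower bound; 0 S-currency; closes NO item; A_nc stmt-23446 / PerNotNcVP / VP ≠ VNP untouched.
[cite: LagardeLimayeSrinivasan2018, §3 Lemma 8] -/
theorem size_binz (P : ArithCircuit R σ) : (binz P).size = (P.gates.map width).sum :=
  length_binBlocks _ _ _

/-- ★ … hence at most gates + wires, `P.size + P.edgeSize` (print size counts wires, LLS18 p. 7:
`O(s)`). MODEL (module docstring);
NOT a new lower bound; 0 S-currency; closes NO item; A_nc stmt-23446 / PerNotNcVP / VP ≠ VNP untouched.
[cite: LagardeLimayeSrinivasan2018, §2 (p. 7), §3 Lemma 8] -/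
theorem size_binz_le (P : ArithCircuit R σ) : (binz P).size ≤ P.size + P.edgeSize := by
  rw [size_binz, size, edgeSize]
  generalize P.gates = gs
  induction gs with
  | nil => simp
  | cons g gs ih =>
    simp only [List.map_cons, List.sum_cons, List.length_cons]
    have := width_le g
    omega

/-- [cite: LagardeLimayeSrinivasan2018, §3 Lemma 8] -/
theorem bop_ne_const (tbl : ℕ → ℕ) {u : Operand R σ} (hu : ∀ c, u ≠ Operand.const c) (c : R) :
    bop tbl u ≠ Operand.const c := by
  cases u with
  | var x => simp [bop]
  | const c' => exact absurd rfl (hu c')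
  | gate j => simp [bop]

end Summit.ValiantsHypothesis.ValiantsHypothesis.Theorems.NcBinarisation
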